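import Summits.ResolutionOfSingularities.ResolutionOfSingularities.Theorems.FrobeniusLadderFInjectiveMacaulayficationFDStorey1PFedder
import Summits.ResolutionOfSingularities.ResolutionOfSingularities.Theorems.FrobeniusLadderFInjectiveMacaulayficationHypersurfaceOriginNotFull
import Summits.ResolutionOfSingularities.ResolutionOfSingularities.Theorems.FrobeniusLadderFInjectiveMacaulayficationFTemkinClosedPoints
import HarnessLib

/-!
# BED D STOREY 1 — THE EXCEPTIONAL POINT `P` IS NOT F-PURE: the local ring of the chart model `k[Y]/(g₂₇₇)` at `𝔪̄_P = (Y₀,Y₁,Y₂+1,Y₃,Y₄)` is NOT FULL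
# (translate `P` to the origin by the characteristic-2 involution `Y₂ ↦ Y₂ + 1`, then Fedder: `τ g₂₇₇ ∈ (Y₀²,…,Y₄²)`)
# (crux `FInjectiveMacaulayfication` stmt-ResolutionOfSingularities-15315, chain w45a; (W-TD) BED D storey 1 (D-1) «P not F-pure», res-L1-w45a-plan-1 R21.18 (4); seat res-L1-w45a-stub-2 g10)

Support file for crux stmt-ResolutionOfSingularities-15315 (`FrobeniusLadder.FInjectiveMacaulayfication`), chain w45a.
[OURS · L1 W4.5a] — NOT a statement of any manuscript; AI-written, weaker than expert review.

★ `not_fullCl_stalk_P` — for the point `P₀` of `Spec k[Y]/(g₂₇₇)` with ideal `𝔪̄_P` (the span of the avoid generators `HS`), `¬ FullCl 2 (𝒪_{P₀})`. PROOF: the involution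
`τ : Y₂ ↦ Y₂ + 1` (`FDStorey1PIdeal.tau_involutive`) induces `k[Y]/(g₂₇₇) ≅ k[Y]/(τ g₂₇₇)` carrying `𝔪̄_P` to the origin; `τ g₂₇₇ ∈ (Y₀², …, Y₄²)` (from the Fedder witness
`FDStorey1PFedder.evalL_G277_mem_frobeniusPower_P`), its constant coefficient vanishes, so the origin of `{τ g₂₇₇ = 0}` is not FULL (res-L1-w45a-stub-1's
`HypersurfaceOriginNotFull.not_fullCl_stalk_origin_of_fedder_mem`); FULL moves along isomorphic stalks. COROLLARY `not_fullCl_of_openImmersion`: for ANY open immersion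
`ι : Spec k[Y]/(g₂₇₇) ⟶ X₁`, `X₁` is NOT FULL at `ι P₀` — storey 2 of BED D (res-L1-w45a-stub-3's (D-2)) is NEEDED. No definitions, no named facts. [cite: Fedder1983, Thm. 1.12]
-/

-- single-problem summit: the doubled namespace component is forced
set_option linter.dupNamespace false

noncomputable section

namespace Summit.ResolutionOfSingularities.ResolutionOfSingularities.Theorems.FInjectiveMacaulayfication.FDStorey1PNotFull

open AlgebraicGeometry CategoryTheory MvPolynomial
open Summit.ResolutionOfSingularities.ResolutionOfSingularities.Theorems.FInjectiveMacaulayfication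
open SliceableCentre FDStorey1Fan FDStorey1PIdeal FDStorey1PFedder

variable (k : Type) [Field k] [CharP k 2]

/-- The involution `τ : Y₂ ↦ Y₂ + 1` as a ring automorphism of `k[Y₀,…,Y₄]` (characteristic 2). [folklore] -/
theorem exists_tauEquiv : ∃ τ : MvPolynomial (Fin 5) k ≃+* MvPolynomial (Fin 5) k,
    ∀ q : MvPolynomial (Fin 5) k, τ q = aeval (fun i : Fin 5 => if i = 2 then (X 2 + 1 : MvPolynomial (Fin 5) k) else X i) q := by
  have hinv := tau_involutive k
  exact ⟨RingEquiv.ofBijective (aeval (fun i : Fin 5 => if i = 2 then (X 2 + 1 : MvPolynomial (Fin 5) k) else X i)).toRingHom hinv.bijective, fun q => rfl⟩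

/-- `τ` maps the Frobenius power `(Y₀², Y₁², (Y₂+1)², Y₃², Y₄²)` into `(Y₀², …, Y₄²)` (`τ (Y₂+1) = Y₂ + 2 = Y₂`). [folklore] -/
theorem map_tau_frobeniusPower_le (τ : MvPolynomial (Fin 5) k ≃+* MvPolynomial (Fin 5) k)
    (hτ : ∀ q : MvPolynomial (Fin 5) k, τ q = aeval (fun i : Fin 5 => if i = 2 then (X 2 + 1 : MvPolynomial (Fin 5) k) else X i) q) :
    (Ideal.span ({X 0 ^ 2, X 1 ^ 2, (X 2 + 1) ^ 2, X 3 ^ 2, X 4 ^ 2} : Set (MvPolynomial (Fin 5) k))).map (τ : _ →+* MvPolynomial (Fin 5) k) ≤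
      Ideal.span (Set.range fun i : Fin 5 => (X i : MvPolynomial (Fin 5) k) ^ 2) := by
  have h2 : (2 : MvPolynomial (Fin 5) k) = 0 := (FermatCubicConeChar2.two_three k (n := 5)).1
  have hX : ∀ i : Fin 5, i ≠ 2 → τ (X i) = X i := fun i hi => by rw [hτ, aeval_X, if_neg hi]
  have hX2 : τ (X 2 + 1) = X 2 := by
    rw [hτ, map_add, map_one, aeval_X, if_pos rfl, add_assoc, show (1 : MvPolynomial (Fin 5) k) + 1 = 2 by norm_num, h2, add_zero]
  rw [Ideal.map_span, Ideal.span_le]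
  rintro _ ⟨q, hq, rfl⟩
  simp only [Set.mem_insert_iff, Set.mem_singleton_iff] at hq
  have hmem : ∀ i : Fin 5, (X i : MvPolynomial (Fin 5) k) ^ 2 ∈ Ideal.span (Set.range fun i : Fin 5 => (X i : MvPolynomial (Fin 5) k) ^ 2) :=
    fun i => Ideal.subset_span ⟨i, rfl⟩
  rcases hq with rfl | rfl | rfl | rfl | rfl
  · rw [SetLike.mem_coe, RingHom.coe_coe, map_pow, hX 0 (by decide)]; exact hmem 0
  · rw [SetLike.mem_coe, RingHom.coe_coe, map_pow, hX 1 (by decide)]; exact hmem 1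
  · rw [SetLike.mem_coe, RingHom.coe_coe, map_pow, hX2]; exact hmem 2
  · rw [SetLike.mem_coe, RingHom.coe_coe, map_pow, hX 3 (by decide)]; exact hmem 3
  · rw [SetLike.mem_coe, RingHom.coe_coe, map_pow, hX 4 (by decide)]; exact hmem 4

/-- `τ` carries `𝔪_P = (Y₀, Y₁, Y₂+1, Y₃, Y₄)` onto the origin ideal `(Y₀, …, Y₄)`. [folklore] -/
theorem map_tau_span_HS (τ : MvPolynomial (Fin 5) k ≃+* MvPolynomial (Fin 5) k)
    (hτ : ∀ q : MvPolynomial (Fin 5) k, τ q = aeval (fun i : Fin 5 => if i = 2 then (X 2 + 1 : MvPolynomial (Fin 5) k) else X i) q) :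
    (Ideal.span {x | x ∈ HS.map (KLocCellKit.evalL k)}).map (τ : _ →+* MvPolynomial (Fin 5) k) = Ideal.span (Set.range (X : Fin 5 → MvPolynomial (Fin 5) k)) := by
  have hτeq : (τ : MvPolynomial (Fin 5) k →+* MvPolynomial (Fin 5) k) =
      (aeval (fun i : Fin 5 => if i = 2 then (X 2 + 1 : MvPolynomial (Fin 5) k) else X i)).toRingHom :=
    RingHom.ext fun q => by
      change τ q = _
      rw [hτ]; rfl
  rw [span_HS_eq_map_tau, Ideal.map_map, hτeq]
  have hid : (aeval (fun i : Fin 5 => if i = 2 then (X 2 + 1 : MvPolynomial (Fin 5) k) else X i)).toRingHom.comp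
      (aeval (fun i : Fin 5 => if i = 2 then (X 2 + 1 : MvPolynomial (Fin 5) k) else X i)).toRingHom = RingHom.id _ :=
    RingHom.ext fun p => (tau_involutive k) p
  rw [hid, Ideal.map_id]

set_option maxHeartbeats 800000 in
-- quotient-equivalence transports
/-- ★ **`P` IS NOT F-PURE**: for the point `P₀` of `Spec k[Y]/(g₂₇₇)` with ideal `𝔪̄_P`, the stalk is NOT FULL. [cite: Fedder1983, Thm. 1.12] -/
theorem not_fullCl_stalk_P (P₀ : Spec (.of (MvPolynomial (Fin 5) k ⧸ Ideal.span {KLocCellKit.evalL k (G (277 : Fin 327))})))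
    (hP₀ : P₀.asIdeal = (Ideal.span {x | x ∈ HS.map (KLocCellKit.evalL k)}).map (Ideal.Quotient.mk (Ideal.span {KLocCellKit.evalL k (G (277 : Fin 327))}))) :
    ¬ FullCl 2 ((Spec (.of (MvPolynomial (Fin 5) k ⧸ Ideal.span {KLocCellKit.evalL k (G (277 : Fin 327))}))).presheaf.stalk P₀) := by
  classical
  haveI : Fact (Nat.Prime 2) := ⟨Nat.prime_two⟩
  obtain ⟨τ, hτ⟩ := exists_tauEquiv k
  -- the translated equation `g' = τ g` and the quotient isomorphism
  have hJ : Ideal.span {τ (KLocCellKit.evalL k (G (277 : Fin 327)))} = (Ideal.span {KLocCellKit.evalL k (G (277 : Fin 327))}).map (τ : MvPolynomial (Fin 5) k →+* MvPolynomial (Fin 5) k) := by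
    rw [Ideal.map_span, Set.image_singleton]; rfl
  let ε : (MvPolynomial (Fin 5) k ⧸ Ideal.span {KLocCellKit.evalL k (G (277 : Fin 327))}) ≃+* (MvPolynomial (Fin 5) k ⧸ Ideal.span {τ (KLocCellKit.evalL k (G (277 : Fin 327)))}) :=
    Ideal.quotientEquiv _ _ τ hJ
  -- facts about `g' = τ g`: non-zero, no constant term, in the Frobenius power of the origin
  have hgnz : KLocCellKit.evalL k (G (277 : Fin 327)) ≠ 0 := fun h0 => by
    have h1 : constantCoeff (KLocCellKit.evalL k (G (277 : Fin 327))) = 1 := by rw [evalL_G277]; simp [constantCoeff_X]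
    rw [h0, map_zero] at h1
    exact zero_ne_one h1
  have hg'0 : τ (KLocCellKit.evalL k (G (277 : Fin 327))) ≠ 0 := fun h => hgnz (τ.injective (by rw [h, map_zero]))
  have hcc : constantCoeff (τ (KLocCellKit.evalL k (G (277 : Fin 327)))) = 0 := by
    rw [hτ]; exact (mem_span_HS_iff k _).mp (evalL_G_mem_span_HS k 277 (Or.inr rfl))
  have hfed : (τ (KLocCellKit.evalL k (G (277 : Fin 327)))) ^ (2 - 1) ∈ Ideal.span (Set.range fun i : Fin 5 => (X i : MvPolynomial (Fin 5) k) ^ 2) := by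
    rw [show (2 - 1 : ℕ) = 1 from rfl, pow_one]
    exact map_tau_frobeniusPower_le k τ hτ (Ideal.mem_map_of_mem _ (evalL_G277_mem_frobeniusPower_P k))
  -- the origin `v'` of `Spec k[Y]/(τ g)` corresponding to `P₀`
  have hv'P : (Spec.map ε.toCommRingCatIso.hom).base ((Spec.map ε.toCommRingCatIso.inv).base P₀) = P₀ := by
    change (Spec.map ε.toCommRingCatIso.inv ≫ Spec.map ε.toCommRingCatIso.hom).base P₀ = P₀
    rw [← Spec.map_comp, Iso.hom_inv_id, Spec.map_id]
    rfl
  have hv' : ((Spec.map ε.toCommRingCatIso.inv).base P₀).asIdeal =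
      Ideal.span (Set.range fun j : Fin 5 => Ideal.Quotient.mk (Ideal.span {τ (KLocCellKit.evalL k (G (277 : Fin 327)))}) (X j)) := by
    rw [Spec.map_apply, PrimeSpectrum.comap_asIdeal, RingEquiv.toCommRingCatIso_inv, CommRingCat.hom_ofHom, hP₀,
      Ideal.comap_coe, Ideal.comap_symm, ← Ideal.map_coe, Ideal.map_map]
    have hcomp : (ε : _ →+* MvPolynomial (Fin 5) k ⧸ Ideal.span {τ (KLocCellKit.evalL k (G (277 : Fin 327)))}).comp (Ideal.Quotient.mk (Ideal.span {KLocCellKit.evalL k (G (277 : Fin 327))})) =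
        (Ideal.Quotient.mk (Ideal.span {τ (KLocCellKit.evalL k (G (277 : Fin 327)))})).comp (τ : MvPolynomial (Fin 5) k →+* MvPolynomial (Fin 5) k) :=
      RingHom.ext fun x => Ideal.quotientEquiv_mk _ _ τ hJ x
    rw [hcomp, ← Ideal.map_map, map_tau_span_HS k τ hτ, Ideal.map_span, ← Set.range_comp]
    rfl
  -- the origin of `{τ g = 0}` is not FULL; move along the isomorphism
  intro hfull
  rw [← hv'P] at hfull
  exact HypersurfaceOriginNotFull.not_fullCl_stalk_origin_of_fedder_mem 2 k (τ (KLocCellKit.evalL k (G (277 : Fin 327)))) hg'0 hcc hfed _ hv'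
    (FTemkinClosedPoints.fullCl_of_isIso_stalkMap' 2 (Spec.map ε.toCommRingCatIso.hom) _ hfull)

/-- ★ COROLLARY: for ANY open immersion `ι : Spec k[Y]/(g₂₇₇) ⟶ X₁`, `X₁` is NOT FULL at `ι P₀` — storey 2 of BED D is needed. [cite: Fedder1983, Thm. 1.12] -/
theorem not_fullCl_of_openImmersion {X₁ : Scheme.{0}}
    (ι : Spec (.of (MvPolynomial (Fin 5) k ⧸ Ideal.span {KLocCellKit.evalL k (G (277 : Fin 327))})) ⟶ X₁) [IsOpenImmersion ι]
    (P₀ : Spec (.of (MvPolynomial (Fin 5) k ⧸ Ideal.span {KLocCellKit.evalL k (G (277 : Fin 327))})))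
    (hP₀ : P₀.asIdeal = (Ideal.span {x | x ∈ HS.map (KLocCellKit.evalL k)}).map (Ideal.Quotient.mk (Ideal.span {KLocCellKit.evalL k (G (277 : Fin 327))}))) :
    ¬ FullCl 2 (X₁.presheaf.stalk (ι.base P₀)) :=
  fun h => not_fullCl_stalk_P k P₀ hP₀ (FTemkinClosedPoints.fullCl_of_isIso_stalkMap' 2 ι P₀ h)

end Summit.ResolutionOfSingularities.ResolutionOfSingularities.Theorems.FInjectiveMacaulayfication.FDStorey1PNotFull

end
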